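import Summits.QuantumFields.YangMills.Theorems.UnitScaleTiltFluctuationComparisonRegPrLiftFaceAssembly

/-!
# Route `UnitScaleTilt` — crux K1bR-pr `FluctuationComparisonRegPr` (stmt-QuantumFields-19201), stub `stub_oneStepSmallLift`
# (W7 line), piece (L2), layer F8a: THE CERTIFICATE BRIDGE — `RowBound` from two finite inequalities per fine-plaquette class
# (fibrewise `ℓ¹` mass of the row functional corrected by a coarse boundary 3-chain, and the chain's `ℓ¹` mass), by summation by parts
# (support file `--supports stmt-QuantumFields-19201`)

Fleet seat `ym-ust-19201-p1` gen 2 (CARD-19201-oneStepSmallLift-L1L2 §1 «NON-EXACT INPUT», §3 (L1) «rows_all_le»/«eChain_l1_le»).  The typed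
certificates (`CertL3Face`, `CertL5`, …) bound, for each of the finitely many fine-plaquette classes, `Σ_{(o,m)} |T(o,m) + (∂e)(o,m)| ≤ λ` and
`Σ_m |e(m)| ≤ β` for an explicit 3-chain `e` on coarse cubes; since `⟨∂e, w⟩ = ⟨e, d₂w⟩`, this gives `‖Φ(w)‖ ≤ λ·sup‖w‖ + β·sup‖d₂w‖` — the
hypothesis `RowBound` of layer F5c.  This file proves that implication ONCE, generically:

* §1 keyed linear functionals `keyedSum c key w = Σ_i c_i • w(key_i)`, their FIBREWISE mass `keyedMass`, and `‖keyedSum‖ ≤ keyedMass · B_w`;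
* §2 the row functional `[edge]·w(o_p; 0) + rowFormC pp μ ν w` as a keyed sum (`rowPhi_eq_keyedSum`), the chain pairing `Σ e•d₂w` as a keyed sum
  (`chainSum_eq_keyedSum`) and its bound by `Σ|e|·B_d`;
* §3 **`rowBound_of_cert`**: `keyedMass (row ⊕ chain) ≤ λ` and `Σ|e| ≤ β` for every class ⇒ `RowBound n R kz λ β`.

The per-`L` data files then only evaluate `keyedMass` and `Σ|e|` on explicit rational tables.  Elementary; nothing of Bałaban's is asserted.
-/

noncomputable section

open scoped BigOperators Matrix.Norms.L2Operator
open NormedSpace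

namespace Summit.QuantumFields.YangMills.Theorems.ApproxLift

open Literature.MathematicalPhysics.QuantumFieldTheory.Balaban1983to89

variable {P : Params} {n : Type*} [Fintype n] [DecidableEq n]

/-! ## §1 Keyed linear functionals and their fibrewise mass -/

/-- The key space: (orientation, integer displacement). -/
abbrev Key (d : ℕ) : Type := Orient d × (Fin d → ℤ)

/-- **A KEYED LINEAR FUNCTIONAL** `Σ_i c_i • w(key_i)` of an orientation/displacement-indexed matrix field. -/
def keyedSum {ι : Type*} [Fintype ι] (c : ι → ℝ) (key : ι → Key P.d) (w : Orient P.d → (Fin P.d → ℤ) → Matrix n n ℂ) : Matrix n n ℂ :=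
  ∑ i, ((c i : ℝ) : ℂ) • w (key i).1 (key i).2

/-- **THE FIBREWISE `ℓ¹` MASS** of a keyed functional: `Σ_{keys} |Σ_{i ↦ key} c_i|` (coefficients hitting the same key are summed BEFORE the
absolute value — this is where the certified cancellations live). -/
def keyedMass {ι : Type*} [Fintype ι] (c : ι → ℝ) (key : ι → Key P.d) : ℝ :=
  ∑ k ∈ Finset.univ.image key, |∑ i ∈ Finset.univ.filter (fun i => key i = k), c i|

omit [Fintype n] [DecidableEq n] in
/-- The fibrewise mass is nonnegative. -/
theorem keyedMass_nonneg {ι : Type*} [Fintype ι] (c : ι → ℝ) (key : ι → Key P.d) : 0 ≤ keyedMass c key :=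
  Finset.sum_nonneg fun _ _ => abs_nonneg _

/-- **`‖Σ_i c_i • w(key_i)‖ ≤ keyedMass · B_w`** when every `‖w(o,m)‖ ≤ B_w`. -/
theorem norm_keyedSum_le {ι : Type*} [Fintype ι] (c : ι → ℝ) (key : ι → Key P.d) (w : Orient P.d → (Fin P.d → ℤ) → Matrix n n ℂ)
    {Bw : ℝ} (hw : ∀ o m, ‖w o m‖ ≤ Bw) : ‖keyedSum c key w‖ ≤ keyedMass c key * Bw := by
  classical
  unfold keyedSum keyedMass
  rw [← Finset.sum_fiberwise_of_maps_to (s := Finset.univ) (t := Finset.univ.image key) (g := key)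
    (fun i _ => Finset.mem_image_of_mem key (Finset.mem_univ i))]
  have hfib : ∀ k ∈ Finset.univ.image key,
      ∑ i ∈ Finset.univ.filter (fun i => key i = k), ((c i : ℝ) : ℂ) • w (key i).1 (key i).2 =
        (((∑ i ∈ Finset.univ.filter (fun i => key i = k), c i : ℝ)) : ℂ) • w k.1 k.2 := fun k _ => by
    rw [Complex.ofReal_sum, Finset.sum_smul]
    exact Finset.sum_congr rfl fun i hi => by rw [(Finset.mem_filter.mp hi).2]
  rw [Finset.sum_congr rfl hfib, Finset.sum_mul]
  refine (norm_sum_le _ _).trans (Finset.sum_le_sum fun k _ => ?_)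
  rw [norm_smul, Complex.norm_real, Real.norm_eq_abs]
  exact mul_le_mul_of_nonneg_left (hw _ _) (abs_nonneg _)

omit [Fintype n] [DecidableEq n] in
/-- Keyed sums over a sum type split. -/
theorem keyedSum_sum {ι₁ ι₂ : Type*} [Fintype ι₁] [Fintype ι₂] (c : ι₁ ⊕ ι₂ → ℝ) (key : ι₁ ⊕ ι₂ → Key P.d)
    (w : Orient P.d → (Fin P.d → ℤ) → Matrix n n ℂ) :
    keyedSum c key w = keyedSum (fun i => c (Sum.inl i)) (fun i => key (Sum.inl i)) w +
      keyedSum (fun i => c (Sum.inr i)) (fun i => key (Sum.inr i)) w := by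
  unfold keyedSum; rw [Fintype.sum_sum_type]

/-! ## §2 The row functional and the chain pairing as keyed sums -/

section Row

variable (R : ℕ) (kz : Fin P.d → (Fin P.d → Fin P.L) → Orient P.d → (Fin P.d → Fin (2 * R + 1)) → ℝ)
variable (μ ν : Fin P.d) (hμν : μ < ν) (pp : Fin P.d → Fin P.L)

/-- Index of the row functional: the face-section term, and the four bonds × (orientation, kernel displacement). -/
abbrev RowIdx (P : Params) (R : ℕ) : Type := Unit ⊕ (Fin 4 × (Orient P.d × (Fin P.d → Fin (2 * R + 1))))

/-- Coefficients of the row functional (signs `(+,+,−,−)`, the four bonds' kernel rows, the edge indicator). -/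
def rowCoef : RowIdx P R → ℝ
  | Sum.inl _ => if exbC pp μ = true ∧ exbC pp ν = true then 1 else 0
  | Sum.inr (b, o, k) =>
    if b = 0 then kz μ pp o k else if b = 1 then kz ν (succOff pp μ) o k
    else if b = 2 then -kz μ (succOff pp ν) o k else -kz ν pp o k

/-- Keys of the row functional (displacements with the block shifts of bonds 2 and 3). -/
def rowKey : RowIdx P R → Key P.d
  | Sum.inl _ => (⟨(μ, ν), hμν⟩, 0)
  | Sum.inr (b, o, k) =>
    if b = 0 then (o, kvec R k) else if b = 1 then (o, bvec (exbC pp μ) μ + kvec R k)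
    else if b = 2 then (o, bvec (exbC pp ν) ν + kvec R k) else (o, kvec R k)

omit [Fintype n] [DecidableEq n] in
/-- **THE ROW FUNCTIONAL AS A KEYED SUM**. -/
theorem rowPhi_eq_keyedSum (w : Orient P.d → (Fin P.d → ℤ) → Matrix n n ℂ) :
    (if exbC pp μ = true ∧ exbC pp ν = true then w ⟨(μ, ν), hμν⟩ 0 else 0) + rowFormC R kz pp μ ν w =
      keyedSum (rowCoef R kz μ ν pp) (rowKey R μ ν hμν pp) w := by
  unfold keyedSum rowFormC
  rw [Fintype.sum_sum_type]
  have hU : ∑ u : Unit, ((rowCoef R kz μ ν pp (Sum.inl u) : ℝ) : ℂ) •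
      w (rowKey R μ ν hμν pp (Sum.inl u)).1 (rowKey R μ ν hμν pp (Sum.inl u)).2 =
      (((if exbC pp μ = true ∧ exbC pp ν = true then (1 : ℝ) else 0 : ℝ)) : ℂ) • w ⟨(μ, ν), hμν⟩ 0 := by
    rw [Fintype.sum_unique]; rfl
  rw [hU, Fintype.sum_prod_type, Fin.sum_univ_four]
  simp only [rowCoef, rowKey, Fintype.sum_prod_type, Fin.isValue, if_true, if_false, show (2 : Fin 4) ≠ 0 by decide,
    show (2 : Fin 4) ≠ 1 by decide, show (3 : Fin 4) ≠ 0 by decide, show (3 : Fin 4) ≠ 1 by decide, show (3 : Fin 4) ≠ 2 by decide,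
    show (1 : Fin 4) ≠ 0 by decide]
  have hF : (if exbC pp μ = true ∧ exbC pp ν = true then w ⟨(μ, ν), hμν⟩ 0 else 0) =
      (((if exbC pp μ = true ∧ exbC pp ν = true then (1 : ℝ) else 0 : ℝ)) : ℂ) • w ⟨(μ, ν), hμν⟩ 0 := by
    split_ifs <;> simp
  rw [hF]
  simp only [Complex.ofReal_neg, neg_smul, Finset.sum_neg_distrib]
  abel

end Row

section Chain

/-- Ordered triples of directions `a < b < c`. -/
abbrev Tri (d : ℕ) : Type := {t : Fin d × Fin d × Fin d // t.1 < t.2.1 ∧ t.2.1 < t.2.2}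

variable (R : ℕ) (e : Tri P.d → (Fin P.d → Fin (2 * (R + 1) + 1)) → ℝ)

/-- **THE CHAIN PAIRING** `Σ_{τ,m} e(τ,m) • (d₂w)(τ; m)` over the cubes of the `(R+1)`-box. -/
def chainSum (w : Orient P.d → (Fin P.d → ℤ) → Matrix n n ℂ) : Matrix n n ℂ :=
  ∑ τ : Tri P.d, ∑ q : Fin P.d → Fin (2 * (R + 1) + 1),
    ((e τ q : ℝ) : ℂ) • d2 w τ.1.1 τ.1.2.1 τ.1.2.2 τ.2.1 τ.2.2 (kvec (R + 1) q)

/-- Index of the chain pairing as a keyed functional: cube × six faces. -/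
abbrev ChainIdx (P : Params) (R : ℕ) : Type := (Tri P.d × (Fin P.d → Fin (2 * (R + 1) + 1))) × Fin 6

/-- Coefficients `±e` of the six faces (signs of `d2`: `+bc(m+e_a) − bc(m) − ac(m+e_b) + ac(m) + ab(m+e_c) − ab(m)`). -/
def chainCoef : ChainIdx P R → ℝ
  | ((τ, q), i) => if i = 0 then e τ q else if i = 1 then -e τ q else if i = 2 then -e τ q else if i = 3 then e τ q
    else if i = 4 then e τ q else -e τ q

/-- Keys of the six faces. -/
def chainKey : ChainIdx P R → Key P.d
  | ((τ, q), i) =>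
    if i = 0 then (⟨(τ.1.2.1, τ.1.2.2), τ.2.2⟩, kvec (R + 1) q + unitZ τ.1.1)
    else if i = 1 then (⟨(τ.1.2.1, τ.1.2.2), τ.2.2⟩, kvec (R + 1) q)
    else if i = 2 then (⟨(τ.1.1, τ.1.2.2), τ.2.1.trans τ.2.2⟩, kvec (R + 1) q + unitZ τ.1.2.1)
    else if i = 3 then (⟨(τ.1.1, τ.1.2.2), τ.2.1.trans τ.2.2⟩, kvec (R + 1) q)
    else if i = 4 then (⟨(τ.1.1, τ.1.2.1), τ.2.1⟩, kvec (R + 1) q + unitZ τ.1.2.2)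
    else (⟨(τ.1.1, τ.1.2.1), τ.2.1⟩, kvec (R + 1) q)

omit [Fintype n] [DecidableEq n] in
/-- **THE CHAIN PAIRING AS A KEYED SUM** (this is `⟨e, d₂w⟩ = ⟨∂e, w⟩`, the summation by parts). -/
theorem chainSum_eq_keyedSum (w : Orient P.d → (Fin P.d → ℤ) → Matrix n n ℂ) :
    chainSum R e w = keyedSum (chainCoef R e) (chainKey R) w := by
  unfold chainSum keyedSum
  rw [Fintype.sum_prod_type, Fintype.sum_prod_type]
  refine Finset.sum_congr rfl fun τ _ => Finset.sum_congr rfl fun q _ => ?_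
  rw [Fin.sum_univ_six]
  simp only [chainCoef, chainKey, Fin.isValue, if_true, if_false, show (2 : Fin 6) ≠ 0 by decide,
    show (2 : Fin 6) ≠ 1 by decide, show (3 : Fin 6) ≠ 0 by decide, show (3 : Fin 6) ≠ 1 by decide, show (3 : Fin 6) ≠ 2 by decide,
    show (4 : Fin 6) ≠ 0 by decide, show (4 : Fin 6) ≠ 1 by decide, show (4 : Fin 6) ≠ 2 by decide, show (4 : Fin 6) ≠ 3 by decide,
    show (5 : Fin 6) ≠ 0 by decide, show (5 : Fin 6) ≠ 1 by decide, show (5 : Fin 6) ≠ 2 by decide, show (5 : Fin 6) ≠ 3 by decide,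
    show (5 : Fin 6) ≠ 4 by decide, show (1 : Fin 6) ≠ 0 by decide, Complex.ofReal_neg, neg_smul]
  unfold d2
  simp only [smul_add, smul_sub]
  abel

/-- **THE CHAIN PAIRING IS BOUNDED BY `Σ|e| · B_d`** when `‖d₂w‖ ≤ B_d` on the cubes of the `(R+1)`-box. -/
theorem norm_chainSum_le (w : Orient P.d → (Fin P.d → ℤ) → Matrix n n ℂ) {Bd : ℝ}
    (hd : ∀ (a b c : Fin P.d) (hab : a < b) (hbc : b < c) (m : Fin P.d → ℤ), (∀ i, (m i).natAbs ≤ R + 1) → ‖d2 w a b c hab hbc m‖ ≤ Bd) :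
    ‖chainSum R e w‖ ≤ (∑ τ : Tri P.d, ∑ q : Fin P.d → Fin (2 * (R + 1) + 1), |e τ q|) * Bd := by
  unfold chainSum
  rw [Finset.sum_mul]
  refine (norm_sum_le _ _).trans (Finset.sum_le_sum fun τ _ => ?_)
  rw [Finset.sum_mul]
  refine (norm_sum_le _ _).trans (Finset.sum_le_sum fun q _ => ?_)
  rw [norm_smul, Complex.norm_real, Real.norm_eq_abs]
  exact mul_le_mul_of_nonneg_left (hd _ _ _ τ.2.1 τ.2.2 _ (natAbs_kvec_le (R + 1) q)) (abs_nonneg _)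

end Chain

/-! ## §3 `RowBound` from the certificate inequalities -/

/-- **THE CERTIFICATE BRIDGE**: if for every fine-plaquette class `(μ<ν, pp)` there is a coarse 3-chain `e` on the cubes of the `(R+1)`-box such
that the FIBREWISE mass of `(row functional) ⊕ (∂e)` is `≤ λ` and `Σ|e| ≤ β`, then `RowBound n R kz λ β` (`d ≥ 3`, i.e. some triple
of directions exists — for `d ≤ 2` there is no `d₂` and the schema degenerates). -/
theorem rowBound_of_cert (hT : Nonempty (Tri P.d)) (R : ℕ) (kz : Fin P.d → (Fin P.d → Fin P.L) → Orient P.d → (Fin P.d → Fin (2 * R + 1)) → ℝ) (lam β : ℝ)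
    (e : ∀ (μ ν : Fin P.d), μ < ν → (Fin P.d → Fin P.L) → Tri P.d → (Fin P.d → Fin (2 * (R + 1) + 1)) → ℝ)
    (hmass : ∀ (μ ν : Fin P.d) (hμν : μ < ν) (pp : Fin P.d → Fin P.L),
      keyedMass (Sum.elim (rowCoef R kz μ ν pp) (chainCoef R (e μ ν hμν pp)))
        (Sum.elim (rowKey R μ ν hμν pp) (chainKey R)) ≤ lam)
    (he : ∀ (μ ν : Fin P.d) (hμν : μ < ν) (pp : Fin P.d → Fin P.L),
      ∑ τ : Tri P.d, ∑ q : Fin P.d → Fin (2 * (R + 1) + 1), |e μ ν hμν pp τ q| ≤ β) :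
    RowBound n R kz lam β := by
  intro μ ν hμν pp w Bw Bd hw hd
  have hBw : 0 ≤ Bw := (norm_nonneg _).trans (hw ⟨(μ, ν), hμν⟩ 0)
  -- `Φ(w) = keyedSum(row ⊕ ∂e) − chainSum`
  have hsplit : (if exbC pp μ = true ∧ exbC pp ν = true then w ⟨(μ, ν), hμν⟩ 0 else 0) + rowFormC R kz pp μ ν w =
      keyedSum (Sum.elim (rowCoef R kz μ ν pp) (chainCoef R (e μ ν hμν pp))) (Sum.elim (rowKey R μ ν hμν pp) (chainKey R)) w -
        chainSum R (e μ ν hμν pp) w := by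
    rw [keyedSum_sum, rowPhi_eq_keyedSum, chainSum_eq_keyedSum]
    simp only [Sum.elim_inl, Sum.elim_inr]
    abel
  rw [hsplit]
  have h1 := norm_keyedSum_le (Sum.elim (rowCoef R kz μ ν pp) (chainCoef R (e μ ν hμν pp)))
    (Sum.elim (rowKey R μ ν hμν pp) (chainKey R)) w hw
  have h2 := norm_chainSum_le R (e μ ν hμν pp) w hd
  obtain ⟨τ⟩ := hT
  have hBd : 0 ≤ Bd := (norm_nonneg _).trans (hd τ.1.1 τ.1.2.1 τ.1.2.2 τ.2.1 τ.2.2 0 (fun i => by simp))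
  calc _ ≤ ‖keyedSum (Sum.elim (rowCoef R kz μ ν pp) (chainCoef R (e μ ν hμν pp))) (Sum.elim (rowKey R μ ν hμν pp) (chainKey R)) w‖ +
        ‖chainSum R (e μ ν hμν pp) w‖ := norm_sub_le _ _
    _ ≤ lam * Bw + β * Bd := add_le_add (h1.trans (mul_le_mul_of_nonneg_right (hmass μ ν hμν pp) hBw))
        (h2.trans (mul_le_mul_of_nonneg_right (he μ ν hμν pp) hBd))

/-- `d = 3` has the triple `(0,1,2)`. -/
theorem nonempty_tri_three : Nonempty (Tri 3) := ⟨⟨(0, 1, 2), by decide, by decide⟩⟩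

end Summit.QuantumFields.YangMills.Theorems.ApproxLift

end
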